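/-
Copyright (c) 2026 the pub-hodgecm-mathlib formalisation cell (harness21).  Prover seat hodgecm-mathlib-K2E3-p17 (g11), HCML Track B «K2-LIT» ∕ h413
(`stmt-HodgeConjecture-24833`), R90-TF section S3, (U3-F) assembly layer B5+B8 «the planted totally real field `ℚ(α)`» (captain's skeleton
`R90/S3/SKELETON-P8-AuxGlobaliseField.K2E3-p17-g11.md` 941dd0e5, steps B5, B8; dealer R90-C12-plan (g2) 01:04:01Z «whoever reaches them first»).  2026-09-05.
-/
import Mathlib.NumberTheory.NumberField.InfinitePlace.TotallyRealComplex
import Mathlib.RingTheory.AdjoinRoot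
import Mathlib.RingTheory.Norm.Basic
import Mathlib.FieldTheory.IntermediateField.Adjoin.Basic
import Mathlib.Algebra.Algebra.Hom.Rat
import HarnessLib

/-!
# R90-TF · S3 · THEOREMS — `R90S3PlantedTotallyRealField` ((U3-F) assembly, layer B5+B8): from a monic `g ∈ ℤ[X]` irreducible over `ℚ` whose complex roots are
# all NEGATIVE REALS, the number field `F = ℚ(α)` (`g(α) = 0`) as a TYPE — totally real, generated by the algebraic integer `α`, `[F : ℚ] = deg g`, every
# conjugate of `α` negative, and `N_{F∕ℚ}(α) = (−1)^{deg g} g(0)`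

R90-TF section S3 (dealer R90-C12-plan (g2)); crux H413 (`stmt-HodgeConjecture-24833`, lane `--supports … --as helper`), route `HCCMUnconditional`.  Steps B5 and B8 of
the (U3-F) assembly behind `stub_R90_S3_auxGlobaliseField`: the planted polynomial of ★ P3b `R90S3PlantedPolynomial.exists_plantedPolynomial` (monic, `g(0) = pᵃ`,
every complex root `z` with `z.im = 0 ∧ z.re < 0`), irreducible over `ℚ` by ★ P4′ ∕ ★ P4, is turned into the TYPE `F := ℚ[X]∕(g)` with exactly the inputs of ★ P7
`R90S3CMOfTotNegRadicand.exists_isCMField_of_forall_re_neg` (`IsTotallyReal F`, `∀ σ : F →+* ℂ, re (σ α) < 0`) and of ★ P5 `R90S3UnitAwayFromPlantedPlace`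
(`|N_{F∕ℚ}(α)| = |g(0)| = pᵃ`), together with the generator property `ℚ⟮α⟯ = ⊤` (for the density step B7) and `IsIntegral ℤ α`.  PURE MATHLIB; THEOREMS ONLY (no
`def`, no `instance`, no notation, no named fact, no `sorry`); never imports `Cruxes/…/Lines`.

THE MATHEMATICS [folklore].  `q := g ⊗ ℚ` is monic irreducible, `F := AdjoinRoot q` is a field, finite over `ℚ` of degree `deg q` (Mathlib `AdjoinRoot.powerBasis`),
hence a number field, generated by `α := root q` (Mathlib `IntermediateField.adjoin_root_eq_top`).  Every `σ : F →+* ℂ` sends `α` to a complex root of `g`, a negative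
real by hypothesis; and `σ` is determined by `σ α` (Mathlib `AdjoinRoot.algHom_ext`), so `conj ∘ σ = σ` — every embedding is REAL, `F` is totally real.  The norm of the
power-basis generator is `(−1)^{deg} · q(0)` (Mathlib `PowerBasis.norm_gen_eq_coeff_zero_minpoly`, `AdjoinRoot.minpoly_powerBasis_gen_of_monic`).
* §1 `aeval_algHom_root_eq_zero`-type helpers: `isRoot_map_of_ringHom_adjoinRoot` (each `σ α` is a complex root of `g`), `ringHom_eq_of_apply_root_eq` (ring
  homomorphisms out of `AdjoinRoot q` agreeing at the root agree).
* §2 **`exists_plantedTotallyRealField`** — the ∃-packaged head (the TYPE `F` with `Field`, `NumberField`, `IsTotallyReal` instances and `α` with its six properties).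
* §3 **`exists_plantedTotallyRealField_with_lift`** (ED. 2) — the same, plus the universal property: every root `β` of `g` in a characteristic-`0` field `K` gives a
  unique `J : F →+* K` with `J α = β` (Mathlib `AdjoinRoot.lift`).

HONEST LABEL: HC_CM is proved only modulo the 7 printed citations (2 remaining named inputs: hLiu418 = stmt-HodgeConjecture-24832, h413 =
stmt-HodgeConjecture-24833) until rung 0 closes; elementary field theory for a sub-step of a GENUINE residual ((U3-F)); proves nothing printed; count-neutral.
References: [Rogawski1990] §13.8 p. 216 (the auxiliary totally real field); [CasselsFrohlichANT1967] Ch. II §6.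
-/

set_option autoImplicit false
-- the mandated namespace repeats the single-problem summit's segment (`HodgeConjecture.HodgeConjecture`)
set_option linter.dupNamespace false

noncomputable section

namespace Summit.HodgeConjecture.HodgeConjecture.R90.S3

open Polynomial NumberField IntermediateField

/-! ## §1 Embeddings of `AdjoinRoot q` are read at the root -/

/-- Every ring homomorphism `σ : AdjoinRoot q →+* ℂ` (`q = g ⊗ ℚ`) maps the root to a complex root of `g`. [folklore] -/
theorem isRoot_map_of_ringHom_adjoinRoot (g : ℤ[X]) (σ : AdjoinRoot (g.map (Int.castRingHom ℚ)) →+* ℂ) :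
    (g.map (Int.castRingHom ℂ)).IsRoot (σ (AdjoinRoot.root (g.map (Int.castRingHom ℚ)))) := by
  have h0 : (g.map (Int.castRingHom ℚ)).eval₂ (AdjoinRoot.of (g.map (Int.castRingHom ℚ))) (AdjoinRoot.root (g.map (Int.castRingHom ℚ))) = 0 :=
    AdjoinRoot.eval₂_root _
  have h1 := congrArg σ h0
  rw [map_zero, Polynomial.hom_eval₂, eval₂_map] at h1
  rw [IsRoot, eval_map]
  convert h1 using 2
  exact Subsingleton.elim _ _

/-- Two ring homomorphisms out of `AdjoinRoot q` (`q ∈ ℚ[X]`) into a `ℚ`-algebra that agree at the root are equal (they are `ℚ`-algebra maps; Mathlib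
`AdjoinRoot.algHom_ext`). [folklore] -/
theorem ringHom_eq_of_apply_root_eq {q : ℚ[X]} {S : Type*} [Field S] [CharZero S] (σ τ : AdjoinRoot q →+* S)
    (h : σ (AdjoinRoot.root q) = τ (AdjoinRoot.root q)) : σ = τ := by
  have := AdjoinRoot.algHom_ext (f := q) (g₁ := σ.toRatAlgHom) (g₂ := τ.toRatAlgHom) (by simpa using h)
  exact RingHom.ext fun x => by simpa using congrArg (fun φ => φ x) this

/-! ## §2 The planted totally real field -/

/-- **THE PLANTED TOTALLY REAL FIELD `ℚ(α)`.**  Let `g ∈ ℤ[X]` be monic with `g ⊗ ℚ` irreducible (★ P4′ sieve ∕ ★ P4) and with every complex root a negative real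
number (★ P3b `exists_plantedPolynomial`).  Then there is a number field `F : Type` which is TOTALLY REAL, with an element `α` such that: `g(α) = 0`, `ℚ⟮α⟯ = ⊤`,
`[F : ℚ] = deg g`, `α` is an algebraic integer, EVERY conjugate of `α` has negative real part (the hypothesis `hγ` of ★ P7 `exists_isCMField_of_forall_re_neg`), and
`N_{F∕ℚ}(α) = (−1)^{deg g} · g(0)`, so `|N_{F∕ℚ}(α)| = |g(0)|` (the hypothesis of ★ P5).  (`F := AdjoinRoot (g ⊗ ℚ)` inside the proof.) [folklore] -/
theorem exists_plantedTotallyRealField (g : ℤ[X]) (hg : g.Monic) (hirr : Irreducible (g.map (Int.castRingHom ℚ)))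
    (hroots : ∀ z : ℂ, (g.map (Int.castRingHom ℂ)).IsRoot z → z.im = 0 ∧ z.re < 0) :
    ∃ (F : Type) (_ : Field F) (_ : NumberField F) (_ : IsTotallyReal F) (α : F),
      aeval α (g.map (Int.castRingHom ℚ)) = 0 ∧ ℚ⟮α⟯ = ⊤ ∧ Module.finrank ℚ F = g.natDegree ∧ IsIntegral ℤ α ∧
      (∀ σ : F →+* ℂ, (σ α).re < 0) ∧ Algebra.norm ℚ α = (-1) ^ g.natDegree * (g.coeff 0 : ℚ) ∧ |Algebra.norm ℚ α| = |(g.coeff 0 : ℚ)| := by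
  set q : ℚ[X] := g.map (Int.castRingHom ℚ) with hqdef
  haveI : Fact (Irreducible q) := ⟨hirr⟩
  have hqm : q.Monic := hg.map _
  have hq0 : q ≠ 0 := hqm.ne_zero
  have hqdeg : q.natDegree = g.natDegree := hg.natDegree_map _
  -- `F := AdjoinRoot q`, a number field of degree `deg g`
  let pb := AdjoinRoot.powerBasis hq0
  haveI : Module.Finite ℚ (AdjoinRoot q) := pb.finite
  haveI hNF : NumberField (AdjoinRoot q) := NumberField.mk
  have hfin : Module.finrank ℚ (AdjoinRoot q) = g.natDegree := by rw [pb.finrank, AdjoinRoot.powerBasis_dim, hqdeg]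
  -- the root and its conjugates
  -- (the two `ℚ`-algebra structures on `AdjoinRoot q` agree: Mathlib `algebra_rat_subsingleton`)
  have haeval : aeval (AdjoinRoot.root q) q = 0 := by
    have h : aeval (AdjoinRoot.root q) q = AdjoinRoot.mk q q := AdjoinRoot.aeval_eq q
    rw [AdjoinRoot.mk_self] at h
    convert h using 2
  have hneg : ∀ σ : AdjoinRoot q →+* ℂ, (σ (AdjoinRoot.root q)).re < 0 := fun σ => (hroots _ (isRoot_map_of_ringHom_adjoinRoot g σ)).2
  have hreal : ∀ σ : AdjoinRoot q →+* ℂ, (σ (AdjoinRoot.root q)).im = 0 := fun σ => (hroots _ (isRoot_map_of_ringHom_adjoinRoot g σ)).1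
  -- every embedding is real: `conj ∘ σ` and `σ` agree at the root
  haveI hTR : IsTotallyReal (AdjoinRoot q) := by
    refine ⟨fun w => ?_⟩
    rw [← w.mk_embedding, InfinitePlace.isReal_mk_iff, ComplexEmbedding.isReal_iff]
    apply ringHom_eq_of_apply_root_eq
    rw [ComplexEmbedding.conjugate_coe_eq, Complex.conj_eq_iff_im, hreal]
  -- the norm of the generator
  have hnorm : Algebra.norm ℚ (AdjoinRoot.root q) = (-1) ^ g.natDegree * (g.coeff 0 : ℚ) := by
    have h := Algebra.PowerBasis.norm_gen_eq_coeff_zero_minpoly pb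
    rw [AdjoinRoot.minpoly_powerBasis_gen_of_monic hqm, AdjoinRoot.powerBasis_gen, AdjoinRoot.powerBasis_dim, hqdeg] at h
    have hq00 : q.coeff 0 = (g.coeff 0 : ℚ) := by rw [hqdef, coeff_map, eq_intCast]
    rw [hq00] at h
    convert h using 2; congr!
  have hint : IsIntegral ℤ (AdjoinRoot.root q) := by
    refine ⟨g, hg, ?_⟩
    have h : aeval (AdjoinRoot.root q) g = 0 := by
      rw [← aeval_map_algebraMap ℚ (AdjoinRoot.root q) g, algebraMap_int_eq]; exact haeval
    rwa [aeval_def] at h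
  refine ⟨AdjoinRoot q, inferInstance, hNF, hTR, AdjoinRoot.root q, haeval, adjoin_root_eq_top q, hfin, hint, hneg, hnorm, ?_⟩
  rw [hnorm, abs_mul, abs_pow, abs_neg, abs_one, one_pow, one_mul]

/-! ## §3 The planted field WITH its universal property (ED. 2, dealer R90-C12-plan (g2) 01:19:31Z) -/

/-- **THE PLANTED TOTALLY REAL FIELD, WITH THE ROOT-LIFT.**  Same as `exists_plantedTotallyRealField`, and moreover: for every field `K` of characteristic `0` and
every root `β ∈ K` of `g`, there is a ring homomorphism `J : F →+* K` with `J α = β`, UNIQUE with this property (the `AdjoinRoot`-free universal property the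
embedding step B7 consumes: `J₀ : F →+* L⁺_v`, `α ↦ β`; `Jᵢ : F →+* ℚ_p`-completions, `α ↦ cᵢ′`).  (Mathlib `AdjoinRoot.lift`, `AdjoinRoot.lift_root`; uniqueness §1.)
[folklore] -/
theorem exists_plantedTotallyRealField_with_lift (g : ℤ[X]) (hg : g.Monic) (hirr : Irreducible (g.map (Int.castRingHom ℚ)))
    (hroots : ∀ z : ℂ, (g.map (Int.castRingHom ℂ)).IsRoot z → z.im = 0 ∧ z.re < 0) :
    ∃ (F : Type) (_ : Field F) (_ : NumberField F) (_ : IsTotallyReal F) (α : F),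
      aeval α (g.map (Int.castRingHom ℚ)) = 0 ∧ ℚ⟮α⟯ = ⊤ ∧ Module.finrank ℚ F = g.natDegree ∧ IsIntegral ℤ α ∧
      (∀ σ : F →+* ℂ, (σ α).re < 0) ∧ Algebra.norm ℚ α = (-1) ^ g.natDegree * (g.coeff 0 : ℚ) ∧ |Algebra.norm ℚ α| = |(g.coeff 0 : ℚ)| ∧
      (∀ (K : Type) [Field K] [CharZero K] (β : K), aeval β (g.map (Int.castRingHom ℚ)) = 0 → ∃ J : F →+* K, J α = β) ∧
      (∀ (K : Type) [Field K] [CharZero K] (J J' : F →+* K), J α = J' α → J = J') := by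
  set q : ℚ[X] := g.map (Int.castRingHom ℚ) with hqdef
  haveI : Fact (Irreducible q) := ⟨hirr⟩
  have hqm : q.Monic := hg.map _
  have hq0 : q ≠ 0 := hqm.ne_zero
  have hqdeg : q.natDegree = g.natDegree := hg.natDegree_map _
  let pb := AdjoinRoot.powerBasis hq0
  haveI : Module.Finite ℚ (AdjoinRoot q) := pb.finite
  haveI hNF : NumberField (AdjoinRoot q) := NumberField.mk
  have hfin : Module.finrank ℚ (AdjoinRoot q) = g.natDegree := by rw [pb.finrank, AdjoinRoot.powerBasis_dim, hqdeg]
  have haeval : aeval (AdjoinRoot.root q) q = 0 := by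
    have h : aeval (AdjoinRoot.root q) q = AdjoinRoot.mk q q := AdjoinRoot.aeval_eq q
    rw [AdjoinRoot.mk_self] at h
    convert h using 2
  have hneg : ∀ σ : AdjoinRoot q →+* ℂ, (σ (AdjoinRoot.root q)).re < 0 := fun σ => (hroots _ (isRoot_map_of_ringHom_adjoinRoot g σ)).2
  have hreal : ∀ σ : AdjoinRoot q →+* ℂ, (σ (AdjoinRoot.root q)).im = 0 := fun σ => (hroots _ (isRoot_map_of_ringHom_adjoinRoot g σ)).1
  haveI hTR : IsTotallyReal (AdjoinRoot q) := by
    refine ⟨fun w => ?_⟩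
    rw [← w.mk_embedding, InfinitePlace.isReal_mk_iff, ComplexEmbedding.isReal_iff]
    apply ringHom_eq_of_apply_root_eq
    rw [ComplexEmbedding.conjugate_coe_eq, Complex.conj_eq_iff_im, hreal]
  have hnorm : Algebra.norm ℚ (AdjoinRoot.root q) = (-1) ^ g.natDegree * (g.coeff 0 : ℚ) := by
    have h := Algebra.PowerBasis.norm_gen_eq_coeff_zero_minpoly pb
    rw [AdjoinRoot.minpoly_powerBasis_gen_of_monic hqm, AdjoinRoot.powerBasis_gen, AdjoinRoot.powerBasis_dim, hqdeg] at h
    have hq00 : q.coeff 0 = (g.coeff 0 : ℚ) := by rw [hqdef, coeff_map, eq_intCast]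
    rw [hq00] at h
    convert h using 2; congr!
  have hint : IsIntegral ℤ (AdjoinRoot.root q) := by
    refine ⟨g, hg, ?_⟩
    have h : aeval (AdjoinRoot.root q) g = 0 := by
      rw [← aeval_map_algebraMap ℚ (AdjoinRoot.root q) g, algebraMap_int_eq]; exact haeval
    rwa [aeval_def] at h
  -- the universal property
  have hlift : ∀ (K : Type) [Field K] [CharZero K] (β : K), aeval β q = 0 → ∃ J : AdjoinRoot q →+* K, J (AdjoinRoot.root q) = β := by
    intro K _ _ β hβ
    refine ⟨AdjoinRoot.lift (algebraMap ℚ K) β (by rwa [aeval_def] at hβ), ?_⟩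
    exact AdjoinRoot.lift_root _
  refine ⟨AdjoinRoot q, inferInstance, hNF, hTR, AdjoinRoot.root q, haeval, adjoin_root_eq_top q, hfin, hint, hneg, hnorm, ?_, hlift,
    fun K _ _ J J' h => ringHom_eq_of_apply_root_eq J J' h⟩
  rw [hnorm, abs_mul, abs_pow, abs_neg, abs_one, one_pow, one_mul]

end Summit.HodgeConjecture.HodgeConjecture.R90.S3

end
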